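import Summits.RiemannHypothesis.RiemannHypothesis.Theorems.TiltedLandingLaw421R3SinkFeedThin
import Summits.RiemannHypothesis.RiemannHypothesis.Theorems.TiltedLandingLaw421R3SinkFeedM

/-!
# W-08 law421 line — regime 3′ SINK: #1268 «SinkFeedM» RE-THREADED ON THE THIN STRIP («SinkFeedThinM», C1 rh-idea-5 g41; support, K-image; E3 twin 2/2 — namespace `RhW08.SinkThin` continued, so every name keeps its sketch-of-record spelling

`RhW08.SinkFeedM.lcert_le_of_kernelDom_mult` / `le_of_certificate_mult` / `norm_farFieldAt_le_of_certificatesExist_mult` (the MULTIPLICITY-netted sink: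
cut points of any order) with the THIN kernel hypothesis `KernelDomThin v.re R Hs cs w σ` (far zeros in `ThinStrip v.re R Hs`; assembly = «SinkThin»'s
`assembly_thin` — the same two changed lines as «SinkFeedThin»): ★★ `norm_farFieldAt_le_of_certificatesExistThin_mult`.  All (K), sorry-free; nothing here
asserts `CertificatesExistThinSig`; RH is not proved here or anywhere in this line; ⟨33346⟩/⟨33347⟩ OPEN.
-/

namespace RhW08.SinkThin

open Complex
open scoped ComplexConjugate
open RhW08.SinkTemplate RhW08.SinkBdry RhW08.SinkConePos RhW08.SinkMirror

section FeedTwins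

open Filter Topology Set
open RhW08.Round1 RhW08.StSwap RhW08.Round2 RhW08.QuadW
open RhW08.SealSwap (PBot)
open RhW08.SealSwapQ RhW08.RateSplit RhW08.IsolatedTilt RhW08.FarStep RhW08.BurgersRate RhW08.PurseP RhW08.BurgersRateG3
open RhIdea6.G17.W07C7 RhIdea6.G17.W07C7.Rev6 RhIdea6.G18.W07C8.Law421BirthS RhIdea6.G19.W07C11.Seam
open RhIdea6.G20.W07C12.Frac RhIdea6.G20.W07C12.StColP RhW07.C12.FieldSplit RhIdea6.G21.W07C13.TentMax
open RhW07.C14.TwoSided RhW07.C14.Classes RhW07.C14.Lineage RhW07.C14.Booking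
open RhW08.FLink RhW08.FLinkGain RhW08.FLinkGainSeam
open RhW08.GainTwoPoint RhW08.FarPricing RhW08.SinkFeed RhW08.FarTwoPointM RhW08.FarPricingM RhW08.SinkFeedM


/-- (K) `RhW08.SinkFeedM.lcert_le_of_kernelDom_mult` with the THIN (K) (two changed lines). -/
theorem lcert_le_of_kernelDomThin_mult {η : ℝ} {f : ℂ → ℂ} {x₀ s hmax R Hs : ℝ} {B : ℕ} (hE : EngineHyps5 2 η f x₀ s hmax R Hs B) {j : ℕ}
    {v w : ℂ} (hRB : LevelRemainderBox η f x₀ s hmax R j) (hcol : |v.re - x₀| ≤ R / 2) (hFv : iteratedDeriv j f v = 0)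
    (hv0 : 0 < v.im)
    (hiso : ∀ z : ℂ, iteratedDeriv j f z = 0 → |z.re - v.re| < R / 2 → z = v ∨ z = conj v)
    (hw : iteratedDeriv j f w ≠ 0) (hwim : 0 < w.im) (hwre : |w.re - v.re| ≤ R / 3)
    {κ : Type} [Fintype κ] {cs : κ → Cut} (hadm : CutsAdmissible v.re cs) (hp0 : ∀ k, iteratedDeriv j f (cs k).p ≠ 0)
    (hpim : ∀ k, 0 < (cs k).p.im ∧ (cs k).p.im ≤ hmax) {σ : ℝ} (hK : KernelDomThin v.re R Hs cs w σ) :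
    Lcert cs (lineRem f j v R w) σ ≤ η / s := by
  obtain ⟨ι, a, hfar, -, -, hexp, htwo, hpull⟩ := im_lineRem_eq_farPull_mult hE hFv hv0 hiso
  have hR : 0 < R := RhW08.ClusterQ.R_pos_of_engine hE
  have hHs0 : 0 ≤ Hs := hE.2.2.2.2.2.2.2.1
  have hHsR : 2 * Hs ≤ R := hE.2.2.2.2.2.2.2.2.2.1
  -- the reflection-symmetric multiplicity of the export
  set n : ℂ → ℝ := fun c ↦ (if c = v ∨ c = conj v then (0 : ℝ) else (analyticOrderNatAt (iteratedDeriv j f) c : ℝ)) with hndef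
  have hn : ∀ c, n (conj c) = n c := by
    intro c
    have h1 : (conj c = v ∨ conj c = conj v) ↔ (c = v ∨ c = conj v) := by
      constructor
      · rintro (h | h)
        · exact Or.inr (by rw [← h, conj_conj])
        · exact Or.inl (by simpa using congrArg conj h)
      · rintro (h | h)
        · exact Or.inr (by rw [h])
        · exact Or.inl (by rw [h, conj_conj])
    simp only [hndef, h1, analyticOrderNatAt, analyticOrderAt_conj_eq hE]
  -- the list: far, in the strip, reflected entries are zeros too; non-zeros avoid the list and its reflection
  have hnz : iteratedDeriv j f ≠ 0 := fun h ↦ hw (by rw [h]; rfl)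
  have hfar' : ∀ i, R / 2 ≤ |(a i).re - v.re| := fun i ↦ (hfar i).2
  have hstripa : ∀ i, |(a i).im| ≤ Hs := fun i ↦ RhW08.Column.abs_im_le_of_level hE hnz (hfar i).1
  have hconj0 : ∀ i, iteratedDeriv j f (conj (a i)) = 0 := fun i ↦ by rw [iteratedDeriv_conj hE, (hfar i).1, map_zero]
  have hav : ∀ {z : ℂ}, iteratedDeriv j f z ≠ 0 → ∀ i, z ≠ a i := fun hz i h ↦ hz (by rw [h]; exact (hfar i).1)
  have havc : ∀ {z : ℂ}, iteratedDeriv j f z ≠ 0 → ∀ i, z ≠ conj (a i) := fun hz i h ↦ hz (by rw [h]; exact hconj0 i)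
  -- the cut points: on the axis, in the slab
  have hpre : ∀ k, (cs k).p.re = v.re := fun k ↦ (hadm.1 k).2.2
  have hpslab : ∀ k, |(cs k).p.re - v.re| ≤ R / 3 := fun k ↦ by
    rw [hpre k, sub_self, abs_zero]; positivity
  -- reference summability `Σ 1/‖w − aᵢ‖² < ∞` (★M's absolute clause at `(w, w)`), and the reflected-source domination constant
  have hsq : Summable (fun i ↦ 1 / (‖w - a i‖ * ‖w - a i‖)) := (htwo w w hw hw).1
  set K : ℝ := 1 + 12 * Hs / R with hKdef
  have hdom : ∀ {p q : ℂ}, |p.re - v.re| ≤ R / 3 → |q.re - v.re| ≤ R / 3 → iteratedDeriv j f p ≠ 0 → iteratedDeriv j f q ≠ 0 →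
      ∀ i, 1 / (‖p - conj (a i)‖ * ‖q - conj (a i)‖) ≤ K ^ 2 * (1 / (‖p - a i‖ * ‖q - a i‖)) :=
    fun hp hq hp0' hq0' i ↦ inv_norm_mul_conj_le hR (hfar' i) (hstripa i) hp hq (hav hp0' i) (hav hq0' i) (havc hp0' i) (havc hq0' i)
  -- (a) the pull at `w` and its reflected twin are summable
  have hSw0 : Summable (fun i ↦ (1 / (w - a i)).im) := (hpull w hw hwim hwre).1
  have hSw : Summable (fun i ↦ (1 / (w - conj (a i))).im) := by
    refine Summable.of_norm_bounded ((hsq.mul_left (K ^ 2)).mul_left (|w.im| + Hs)) fun i ↦ ?_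
    rw [Real.norm_eq_abs]
    have h1 := abs_im_one_div_sub_le (w := w) (a := conj (a i)) (Hs := Hs) hR (by rw [conj_re]; exact hfar' i)
      (by rw [conj_im, abs_neg]; exact hstripa i) hwre (havc hw i)
    rw [sub_self, norm_zero, mul_zero, zero_div, add_zero, one_pow, mul_one] at h1
    exact h1.trans (mul_le_mul_of_nonneg_left (hdom hwre hwre hw hw i) (add_nonneg (abs_nonneg _) hHs0))
  -- (b) the two-point differences at `(w, p_k)` and their reflected twins are summable
  have hSc : ∀ k, Summable (fun i ↦ (1 / (w - conj (a i)) - 1 / ((cs k).p - conj (a i)))) := by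
    intro k
    by_cases hwp : w = (cs k).p
    · rw [← hwp]
      simp only [sub_self]
      exact summable_zero
    have h1 : Summable (fun i ↦ 1 / (‖w - a i‖ * ‖(cs k).p - a i‖)) := (htwo w (cs k).p hw (hp0 k)).1
    refine Summable.of_norm_bounded ((h1.mul_left (K ^ 2)).mul_left ‖(cs k).p - w‖) fun i ↦ ?_
    have e1 : w - conj (a i) ≠ 0 := sub_ne_zero.mpr (havc hw i)
    have e2 : (cs k).p - conj (a i) ≠ 0 := sub_ne_zero.mpr (havc (hp0 k) i)
    have : 1 / (w - conj (a i)) - 1 / ((cs k).p - conj (a i)) = ((cs k).p - w) / ((w - conj (a i)) * ((cs k).p - conj (a i))) := by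
      field_simp
      ring
    rw [this, norm_div, norm_mul, div_eq_mul_one_div]
    exact mul_le_mul_of_nonneg_left (hdom hwre (hpslab k) hw (hp0 k) i) (norm_nonneg _)
  -- the pair kernel splits into the list term and its reflected twin
  have hpk : ∀ k i, farPairK (a i) w - farPairK (a i) (cs k).p =
      (1 / (w - a i) - 1 / ((cs k).p - a i)) + (1 / (w - conj (a i)) - 1 / ((cs k).p - conj (a i))) := by
    intro k i
    unfold farPairK
    ring
  -- real parts along a direction
  have hgk : ∀ k, Summable (fun i ↦ (conj (cs k).e * (1 / (w - a i) - 1 / ((cs k).p - a i))).re) := fun k ↦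
    (Complex.hasSum_re (((htwo w (cs k).p hw (hp0 k)).2.1).mul_left _).hasSum).summable
  have hgkc : ∀ k, Summable (fun i ↦ (conj (cs k).e * (1 / (w - conj (a i)) - 1 / ((cs k).p - conj (a i)))).re) := fun k ↦
    (Complex.hasSum_re ((hSc k).mul_left _).hasSum).summable
  -- re-pairing: the reflected twins sum to the same value
  have hrep : ∀ k, ∑' i, (conj (cs k).e * (1 / (w - conj (a i)) - 1 / ((cs k).p - conj (a i)))).re =
      ∑' i, (conj (cs k).e * (1 / (w - a i) - 1 / ((cs k).p - a i))).re := fun k ↦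
    tsum_conj_eq (g := fun c ↦ (conj (cs k).e * (1 / (w - c) - 1 / ((cs k).p - c))).re) hn hexp (hgk k) (hgkc k)
  have hrepI : ∑' i, (1 / (w - conj (a i))).im = ∑' i, (1 / (w - a i)).im :=
    tsum_conj_eq (g := fun c ↦ (1 / (w - c)).im) hn hexp hSw0 hSw
  -- the hypotheses of `AssemblySig`, one by one
  have hm : ∀ _ : ι, (0 : ℝ) ≤ 1 / 2 := fun _ ↦ by norm_num
  have hstrip : ∀ i, ThinStrip v.re R Hs (a i) := fun i ↦ ⟨hfar' i, hstripa i⟩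
  have hsum : ∀ k, Summable fun i ↦ (1 / 2 : ℝ) * (conj (cs k).e * (farPairK (a i) w - farPairK (a i) (cs k).p)).re := by
    intro k
    refine (((hgk k).add (hgkc k)).mul_left (1 / 2)).congr fun i ↦ ?_
    rw [hpk k i, mul_add (conj (cs k).e), add_re]
  have hsumc : Summable fun i ↦ (1 / 2 : ℝ) * farPairC w (a i) := by
    refine ((hSw0.add hSw).mul_left (-(1 / 2))).congr fun i ↦ ?_
    simp only [farPairC, farPairK, add_im]
    ring
  have hEq : -(lineRem f j v R w).im = ∑' i, (1 / 2 : ℝ) * farPairC w (a i) := by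
    have e1 : ∀ i, (1 / 2 : ℝ) * farPairC w (a i) = -(1 / 2) * ((1 / (w - a i)).im + (1 / (w - conj (a i))).im) := by
      intro i
      simp only [farPairC, farPairK, add_im]
      ring
    rw [tsum_congr e1, tsum_mul_left, hSw0.tsum_add hSw, hrepI, (hpull w hw hwim hwre).2.1]
    ring
  have hseam : ∀ k, (conj (cs k).e * lineRem f j v R w).re -
      ∑' i, (1 / 2 : ℝ) * (conj (cs k).e * (farPairK (a i) w - farPairK (a i) (cs k).p)).re ≤ η / s := by
    intro k
    have e1 : ∀ i, (1 / 2 : ℝ) * (conj (cs k).e * (farPairK (a i) w - farPairK (a i) (cs k).p)).re =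
        (1 / 2 : ℝ) * ((conj (cs k).e * (1 / (w - a i) - 1 / ((cs k).p - a i))).re +
          (conj (cs k).e * (1 / (w - conj (a i)) - 1 / ((cs k).p - conj (a i)))).re) := by
      intro i
      rw [hpk k i, mul_add (conj (cs k).e), add_re]
    obtain ⟨-, hd, hid⟩ := htwo w (cs k).p hw (hp0 k)
    have e2 : ∑' i, (conj (cs k).e * (1 / (w - a i) - 1 / ((cs k).p - a i))).re =
        (conj (cs k).e * (lineRem f j v R w - lineRem f j v R (cs k).p)).re := by
      rw [hid, ← tsum_mul_left, Complex.re_tsum (hd.mul_left _)]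
    rw [tsum_congr e1, tsum_mul_left, (hgk k).tsum_add (hgkc k), hrep k, e2]
    have hseamk : ‖lineRem f j v R (cs k).p‖ ≤ η / s :=
      norm_lineRem_le_of_seam hRB (hpre k) hcol (by rw [abs_of_pos (hpim k).1]; exact (hpim k).2) (hp0 k)
    have hre : (conj (cs k).e * lineRem f j v R (cs k).p).re ≤ η / s := by
      refine (Complex.re_le_norm _).trans ?_
      rw [norm_mul, Complex.norm_conj, (hadm.1 k).2.1, one_mul]
      exact hseamk
    have e3 : (conj (cs k).e * lineRem f j v R w).re -
        1 / 2 * ((conj (cs k).e * (lineRem f j v R w - lineRem f j v R (cs k).p)).re +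
          (conj (cs k).e * (lineRem f j v R w - lineRem f j v R (cs k).p)).re) =
        (conj (cs k).e * lineRem f j v R (cs k).p).re := by
      rw [mul_sub, sub_re]
      ring
    rw [e3]
    exact hre
  exact assembly_thin κ ι a (fun _ ↦ 1 / 2) v.re R Hs cs w (lineRem f j v R w) (η / s) σ hm hstrip hadm hK hsum hsumc hEq hseam

/-- (K) `RhW08.SinkFeedM.le_of_certificate_mult` with the THIN (K). -/
theorem le_of_certificate_thin_mult {η : ℝ} {f : ℂ → ℂ} {x₀ s hmax R Hs : ℝ} {B : ℕ} (hE : EngineHyps5 2 η f x₀ s hmax R Hs B)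
    {j : ℕ} {v w : ℂ} (hRB : LevelRemainderBox η f x₀ s hmax R j) (hcol : |v.re - x₀| ≤ R / 2) (hFv : iteratedDeriv j f v = 0)
    (hv0 : 0 < v.im)
    (hiso : ∀ z : ℂ, iteratedDeriv j f z = 0 → |z.re - v.re| < R / 2 → z = v ∨ z = conj v)
    (hw : iteratedDeriv j f w ≠ 0) (hwim : 0 < w.im) (hwre : |w.re - v.re| ≤ R / 3)
    {κ : Type} [Fintype κ] {cs : κ → Cut} (hadm : CutsAdmissible v.re cs) (hp0 : ∀ k, iteratedDeriv j f (cs k).p ≠ 0)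
    (hpim : ∀ k, 0 < (cs k).p.im ∧ (cs k).p.im ≤ hmax) {σ lam gnorm : ℝ} (hlam : 0 < lam) (hK : KernelDomThin v.re R Hs cs w σ)
    (hD : DatumAlt lam s gnorm cs (lineRem f j v R w) σ) : gnorm ≤ lam * η / s := by
  have hL := lcert_le_of_kernelDomThin_mult hE hRB hcol hFv hv0 hiso hw hwim hwre hadm hp0 hpim hK
  have hs0 : 0 < s := hE.2.2.2.1
  have hη2 : 2 * η ≤ 1 := hE.2.2.2.2.2.2.2.2.2.2.2.2.2.2.1
  rcases hD with h | h
  · have h' := h.trans hL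
    rw [div_le_iff₀ hlam] at h'
    calc gnorm ≤ η / s * lam := h'
      _ = lam * η / s := by ring
  · exfalso
    have h1 : 1 / (2 * s) < η / s := h.trans_le hL
    rw [div_lt_div_iff₀ (by positivity) hs0] at h1
    nlinarith

/-- ★ (K) `RhW08.SinkFeedM.norm_farFieldAt_le_of_certificatesExist_mult` from the THIN claim, extra frame fact `2·(Hs + hmax) ≤ R`. -/
theorem norm_farFieldAt_le_of_certificatesExistThin_mult {lam : ℝ} (hcert : CertificatesExistThinSig lam) (hlam : 0 < lam) {η : ℝ} {f : ℂ → ℂ}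
    {x₀ s hmax R Hs : ℝ} {B : ℕ} (hE : EngineHyps5 2 η f x₀ s hmax R Hs B) {j : ℕ} {v w : ℂ} (hRB : LevelRemainderBox η f x₀ s hmax R j)
    (hcol : |v.re - x₀| ≤ R / 2) (hFv : iteratedDeriv j f v = 0) (hv0 : 0 < v.im) (hvh : v.im < hmax)
    (hiso : ∀ z : ℂ, iteratedDeriv j f z = 0 → |z.re - v.re| < R / 2 → z = v ∨ z = conj v)
    (hw : iteratedDeriv j f w ≠ 0) (hw' : iteratedDeriv (j + 1) f w = 0) (hwim : 0 < w.im) (hdrop : v.im - s / 4 < w.im)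
    (hdisc : ‖w - (v.re : ℂ)‖ ≤ |v.im|) (hHR : 2 * (Hs + hmax) ≤ R) : ‖farFieldAt f j v w‖ ≤ lam * η / s := by
  have hs0 : 0 < s := hE.2.2.2.1
  have h2s : 2 * s ≤ hmax := hE.2.2.2.2.1
  have h3R : 3 * hmax < R := hE.2.2.2.2.2.2.1
  have hR : 0 < R := RhW08.ClusterQ.R_pos_of_engine hE
  -- the nested disc in coordinates
  have hdisc' : ‖w - (v.re : ℂ)‖ ≤ v.im := by rwa [abs_of_pos hv0] at hdisc
  have hn2 : ‖w - (v.re : ℂ)‖ ^ 2 = (w.re - v.re) ^ 2 + w.im ^ 2 := by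
    rw [Complex.sq_norm, Complex.normSq_apply]
    simp
    ring
  have hsq : (w.re - v.re) ^ 2 + w.im ^ 2 ≤ v.im ^ 2 := by
    rw [← hn2]
    exact pow_le_pow_left₀ (norm_nonneg _) hdisc' 2
  have hwle : w.im ≤ v.im := by
    have h := abs_le_of_sq_le_sq (a := w.im) (b := v.im) (by nlinarith [sq_nonneg (w.re - v.re)]) hv0.le
    rwa [abs_of_pos hwim] at h
  have hwlt : w.im < v.im := by
    rcases lt_or_eq_of_le hwle with h | h
    · exact h
    · exfalso
      have hre : (w.re - v.re) ^ 2 ≤ 0 := by nlinarith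
      have hre0 : w.re - v.re = 0 := pow_eq_zero_iff two_ne_zero |>.mp (le_antisymm hre (sq_nonneg _))
      exact hw (by rw [Complex.ext (by linarith) h]; exact hFv)
  have hwre : |w.re - v.re| ≤ R / 3 := by
    have h1 : |w.re - v.re| ≤ v.im := abs_le_of_sq_le_sq (by nlinarith [sq_nonneg w.im]) hv0.le
    linarith
  -- C3's certificate at the state's multiplicity `m = ord_v f⁽ʲ⁾ ≥ 1`
  have hm1 : 1 ≤ (analyticOrderAt (iteratedDeriv j f) v).toNat := one_le_order_toNat hE hFv hw
  obtain ⟨n, cs, σ, hadm, hpts, hK, hD⟩ :=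
    hcert v.re R s hmax Hs v w _ hs0 h2s h3R hE.2.2.2.2.2.2.2.1 hHR rfl hv0 hvh.le hwim hwlt hdrop hsq hm1
  -- the cut points are non-zeros of the box, off `v`
  have hpfacts : ∀ k, iteratedDeriv j f (cs k).p ≠ 0 ∧ 0 < (cs k).p.im ∧ (cs k).p.im ≤ hmax := by
    intro k
    have hoff : ∀ p : ℂ, p.re = v.re → 0 < p.im → p.im ≠ v.im → iteratedDeriv j f p ≠ 0 := by
      intro p hpre hpim hpv hz
      rcases hiso p hz (by rw [hpre, sub_self, abs_zero]; linarith) with h | h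
      · exact hpv (by rw [h])
      · have : p.im = -v.im := by rw [h, conj_im]
        linarith
    rcases hpts k with h | h
    · have hre : (cs k).p.re = v.re := by rw [h]
      have him : (cs k).p.im = w.im := by rw [h]
      exact ⟨hoff _ hre (by rw [him]; exact hwim) (by rw [him]; exact hwlt.ne), by rw [him]; exact hwim, by rw [him]; linarith⟩
    · have hre : (cs k).p.re = v.re := by rw [h]
      have him : (cs k).p.im = hmax := by rw [h]
      exact ⟨hoff _ hre (by rw [him]; linarith) (by rw [him]; exact hvh.ne'), by rw [him]; linarith, by rw [him]⟩
  -- the read value of the certificate is the line remainder `−m·K_v(w)` (closed form at a child), the bounded modulus is the far field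
  have hFcv : iteratedDeriv j f (conj v) = 0 := by rw [iteratedDeriv_conj hE, hFv, map_zero]
  have hL1 : lineRem f j v R w = -(((analyticOrderAt (iteratedDeriv j f) v).toNat : ℂ) * farPairK v w) := by
    rw [lineRem_eq hiso hFv hFcv hR hv0 w, levelField_child hw', analyticOrderAt_conj_eq hE, farPairK]
    simp only [one_div]
    ring
  have hN : ‖farPairK v w‖ = ‖farFieldAt f j v w‖ := by
    rw [farFieldAt_child v hw', norm_neg, farPairK]
    simp only [one_div]
  rw [← hL1, hN] at hD
  exact le_of_certificate_thin_mult hE hRB hcol hFv hv0 hiso hw hwim hwre hadm (fun k ↦ (hpfacts k).1) (fun k ↦ (hpfacts k).2) hlam hK hD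

end FeedTwins

end RhW08.SinkThin
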